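import Literature.Geometry.Lorentzian.CoordCurvatureStarDerivatives
import Literature.Geometry.Lorentzian.CoordShrinkerRmNormSqDrift
import HarnessLib

/-!
# `Δ_f ∇Rm = 3λ ∇Rm + Rm ∗ ∇Rm` and the drift inequality for `|∇Rm|²` on a gradient soliton

Continuation of `CoordShrinkerRmNormSqDrift.lean` (`Δ_f Rm = 2λRm + Rm ∗ Rm`, Munteanu–Wang 2015,
formula (id)) and of `CoordCurvatureStarDerivatives.lean` (the `Rm ∗ ∇Rm` bookkeeping): metric
components `G : E → (E →L E →L ℝ)`, smooth, symmetric and nondegenerate on an open set `V`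
(`IsMetricOn G V`), a smooth potential `f` with the gradient Ricci soliton equation
`Ric + Hess f = λ G` on `V` (`λ = ½`: shrinkers), a basis `b`; `rm4`, `tcov`, `tlap`, `tnormSq` are
the component tensor calculus of `CoordTensorCalculus.lean`, `∇f = ♯Df`. We PROVE:

* `IsMetricOn.tlap_rm4_sub_drift_of_soliton` — (id) as an identity of component fields:
  `Δ rm4 − ∇_{∇f} rm4 − 2λ rm4` is an explicit combination of the `Rm ∗ Rm` monomials `rrField`;
  hence **`IsMetricOn.sqrt_tnormSq_tcov_lapDrift_le`: `|∇(Δ_f Rm − 2λRm)| ≤ 20 n |Rm| |∇Rm|`**;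
* `IsMetricOn.sum_coord_sharpAt_mul_riemCoef`, `IsMetricOn.sum_coord_sharpAt_ricTerm_eq` —
  `R(·,∇f) = d^∇Ric` (`cov₂At_ricAt_sub_of_soliton`) makes the curvature term of
  `∇(∇_{∇f}Rm) − ∇_{∇f}(∇Rm)` a `∇Ric ∗ Rm` term (the `∂_tΓ ∗ T` bookkeeping of the Ricci flow);
* **`IsMetricOn.tlap_tcov_rm4_sub_drift_of_soliton` — Munteanu–Wang 2015, Prop. 2.2, formula (u1):
  `Δ_f(∇Rm) = 3λ ∇Rm + Rm ∗ ∇Rm`** (for any `λ`, with the four `∗`-terms explicit: `[Δ,∇]Rm`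
  (Topping's (2.1.6)), `∇(Δ_fRm − 2λRm)`, `−Ric ⋆ ∇Rm` and `−d^∇Ric ∗ Rm`);
* **`IsMetricOn.lapAt_tnormSq_tcov_rm4_sub_fderiv_ge_of_soliton` — the Shi-type drift inequality
  of the proof of Thm. 1.4 (p. 6): `Δ|∇Rm|² − d|∇Rm|²(∇f) ≥ 2|∇²Rm|² + 6λ|∇Rm|² − 84 n √(|Rm|²) |∇Rm|²`**
  ((u1), `Δ|T|² = 2⟨ΔT,T⟩ + 2|∇T|²`, `d|T|²(W) = 2⟨∇_W T, T⟩`, Cauchy–Schwarz; Kato's inequality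
  `|∇|∇Rm|²|² ≤ 4|∇Rm|²|∇²Rm|²` is `IsMetricOn.gradSqAt_tnormSq_le` of `CoordCurvatureStarDerivatives`).

Everything is proved; no definition and no statement of `Prop` type is introduced.

## References

* O. Munteanu, J. Wang, *Geometry of shrinking Ricci solitons*, Compositio Math. 151 (2015)
  2273–2300 = arXiv:1410.3813, §1 (id), Thm. 1.4 (proof: the Shi estimate, p. 6) and Prop. 2.2
  with (u1) (p. 7). [MunteanuWang2015]
* M. Eminenti, G. La Nave, C. Mantegazza, *Ricci solitons: the equation point of view*,
  manuscripta math. 127 (2008), Prop. 2.1. [EminentiLanaveMantegazza2008]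
* P. Topping, *Lectures on the Ricci flow*, LMS Lecture Note Series 325, CUP 2006, (2.1.6),
  §3.2 (p. 37), §3.3. [Topping2006]
-/

noncomputable section

set_option maxSynthPendingDepth 3

open Set Filter ContinuousLinearMap Module Function
open scoped Topology ContDiff

namespace Literature.Geometry.Lorentzian

namespace MetricCoord

variable {E : Type*} [NormedAddCommGroup E] [NormedSpace ℝ E] {ι : Type*}

/-! ### `Δ_f Rm − 2λ Rm = Rm ∗ Rm` as a component field and `∇` of it -/

section SolitonLap

variable [Fintype ι] {G : E → E →L[ℝ] E →L[ℝ] ℝ} (b : Basis ι ℝ E) {V : Set E} {x : E}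
  [FiniteDimensional ℝ E] [CompleteSpace E] {f : E → ℝ} {lam : ℝ}

/-- **Munteanu–Wang's (id) as an identity of component fields**: on a gradient soliton
`Ric + Hess f = λG`, on `V`, `Δ rm4 − ∇_{∇f} rm4 − 2λ rm4 = Ric ∗ Rm + Rm ∗ Rm`, explicitly
`= F₆ ∘ (2,3,0,1) − F₆ ∘ (2,3,1,0) − Q₀ + Q₀ ∘ (01)` with `Q₀ = F₁ − F₂ − F₃ − F₄` and
`F_e = rrField G b rrEquiv_e` the double traces of `Rm ⊗ Rm` (`apply_lapRiemAt_of_soliton`,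
`quadField_eq`, `ricRField₂_eq`). [cite: MunteanuWang2015, Thm. 1.4 (proof) and (u1)] -/
theorem IsMetricOn.tlap_rm4_sub_drift_of_soliton (hG : IsMetricOn G V) (hf : ContDiffOn ℝ ∞ f V)
    (hsol : ∀ y ∈ V, ∀ v w, ricAt G y v w + hessAt G f y v w = lam * G y v w) :
    ∀ y ∈ V, ∀ J, tlap G b (rm4 G b) y J
        - ∑ q, b.coord q (sharpAt G y (fderiv ℝ f y)) * tcov G b (rm4 G b) y (ocons q J)
        - 2 * lam * rm4 G b y J =
      (treindex (Equiv.ofBijective ![(2 : Fin 4), 3, 0, 1] (by decide)) (rrField G b rrEquiv₆)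
        - treindex (Equiv.ofBijective ![(2 : Fin 4), 3, 1, 0] (by decide)) (rrField G b rrEquiv₆)
        - (rrField G b rrEquiv₁ - rrField G b rrEquiv₂ - rrField G b rrEquiv₃ - rrField G b rrEquiv₄)
        + treindex (Equiv.swap (0 : Fin 4) 1)
            (rrField G b rrEquiv₁ - rrField G b rrEquiv₂ - rrField G b rrEquiv₃ - rrField G b rrEquiv₄)) y J := by
  intro y hy J
  have hi := hG.isInvertible y hy
  rw [hG.sum_coord_mul_tcov_rm4 b hy, eq_vec4 J, hG.tlap_rm4 b hy, hG.apply_lapRiemAt_of_soliton b hy hf hsol]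
  simp only [Matrix.cons_val_zero, Matrix.cons_val_one, Matrix.cons_val, Pi.add_apply, Pi.sub_apply,
    treindex_apply, Equiv.coe_ofBijective, vec4_comp_perm₁, vec4_comp_perm₂, vec4_comp_swap01,
    ← quadField_eq b hi, ← ricRField₂_eq b hi, rm4_vec]
  simp only [quadField, ricRField₂, Matrix.cons_val_zero, Matrix.cons_val_one, Matrix.cons_val]
  ring

/-- **`|∇(Δ_f Rm − 2λRm)| ≤ 20 n |Rm| |∇Rm|`** on a gradient soliton, at positive definite points:
`∇` of the `Rm ∗ Rm` field of `tlap_rm4_sub_drift_of_soliton` is a sum of ten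
`∇(Rm ∗ Rm monomial)`s (`sqrt_tnormSq_tcov_rrField_le`). [cite: MunteanuWang2015, Thm. 1.4 (proof) and (u1)] -/
theorem IsMetricOn.sqrt_tnormSq_tcov_lapDrift_le (hG : IsMetricOn G V) (hx : x ∈ V)
    (hpos : ∀ v, v ≠ 0 → 0 < G x v v) (hf : ContDiffOn ℝ ∞ f V)
    (hsol : ∀ y ∈ V, ∀ v w, ricAt G y v w + hessAt G f y v w = lam * G y v w) :
    Real.sqrt (tnormSq G b (tcov G b (fun y J ↦ tlap G b (rm4 G b) y J
        - ∑ q, b.coord q (sharpAt G y (fderiv ℝ f y)) * tcov G b (rm4 G b) y (ocons q J)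
        - 2 * lam * rm4 G b y J)) x) ≤
      20 * Fintype.card ι * Real.sqrt (tnormSq G b (rm4 G b) x) *
        Real.sqrt (tnormSq G b (tcov G b (rm4 G b)) x) := by
  have hs := hG.symm x hx
  have hV := hG.isOpen
  have hT := hG.tsmoothOn_rm4 b
  have hF : ∀ e, TSmoothOn (rrField G b e) V := fun e ↦
    hG.tsmoothOn_ttr (hG.tsmoothOn_ttr ((hT.tprod hT).treindex e))
  set Q0 := rrField G b rrEquiv₁ - rrField G b rrEquiv₂ - rrField G b rrEquiv₃ - rrField G b rrEquiv₄ with hQ0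
  have hQ0s : TSmoothOn Q0 V := (((hF _).sub (hF _)).sub (hF _)).sub (hF _)
  set A := treindex (Equiv.ofBijective ![(2 : Fin 4), 3, 0, 1] (by decide)) (rrField G b rrEquiv₆) with hA
  set B := treindex (Equiv.ofBijective ![(2 : Fin 4), 3, 1, 0] (by decide)) (rrField G b rrEquiv₆) with hB
  set C := treindex (Equiv.swap (0 : Fin 4) 1) Q0 with hC
  have hAs : TSmoothOn A V := (hF _).treindex _
  have hBs : TSmoothOn B V := (hF _).treindex _
  have hCs : TSmoothOn C V := hQ0s.treindex _
  set D := tcov G b (rrField G b rrEquiv₁) - tcov G b (rrField G b rrEquiv₂) - tcov G b (rrField G b rrEquiv₃)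
    - tcov G b (rrField G b rrEquiv₄) with hD
  have hq : ∀ K', tcov G b Q0 x K' = D x K' := by
    intro K'
    rw [hQ0, tcov_sub_apply hV (((hF _).sub (hF _)).sub (hF _)) (hF _) hx,
      tcov_sub_apply hV ((hF _).sub (hF _)) (hF _) hx, tcov_sub_apply hV (hF _) (hF _) hx, hD]
    simp only [Pi.sub_apply]
  have heq : ∀ K, tcov G b (fun y J ↦ tlap G b (rm4 G b) y J
      - ∑ q, b.coord q (sharpAt G y (fderiv ℝ f y)) * tcov G b (rm4 G b) y (ocons q J)
      - 2 * lam * rm4 G b y J) x K =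
      (treindex (Equiv.ofBijective ![(2 : Fin 4), 3, 0, 1] (by decide)).optionCongr (tcov G b (rrField G b rrEquiv₆))
        - treindex (Equiv.ofBijective ![(2 : Fin 4), 3, 1, 0] (by decide)).optionCongr (tcov G b (rrField G b rrEquiv₆))
        - D + treindex (Equiv.swap (0 : Fin 4) 1).optionCongr D) x K := by
    intro K
    rw [tcov_congr hV (hG.tlap_rm4_sub_drift_of_soliton b hf hsol) hx K]
    rw [← hQ0, ← hA, ← hB, ← hC, tcov_add_apply hV ((hAs.sub hBs).sub hQ0s) hCs hx,
      tcov_sub_apply hV (hAs.sub hBs) hQ0s hx, tcov_sub_apply hV hAs hBs hx, hA, hB, hC]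
    simp only [Pi.add_apply, Pi.sub_apply, tcov_treindex, treindex_apply, hq]
  rw [IsMetricFamilyOn.tnormSq_congr_point b heq]
  -- the bound
  set M := 2 * Fintype.card ι * Real.sqrt (tnormSq G b (rm4 G b) x) *
    Real.sqrt (tnormSq G b (tcov G b (rm4 G b)) x) with hM
  have hb : ∀ e, Real.sqrt (tnormSq G b (tcov G b (rrField G b e)) x) ≤ M :=
    fun e ↦ hG.sqrt_tnormSq_tcov_rrField_le b hx hpos e
  have hDn : Real.sqrt (tnormSq G b D x) ≤ 4 * M := by
    have e1 := sqrt_tnormSq_sub_le b hs hpos (tcov G b (rrField G b rrEquiv₁) - tcov G b (rrField G b rrEquiv₂)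
      - tcov G b (rrField G b rrEquiv₃)) (tcov G b (rrField G b rrEquiv₄))
    have e2 := sqrt_tnormSq_sub_le b hs hpos (tcov G b (rrField G b rrEquiv₁) - tcov G b (rrField G b rrEquiv₂))
      (tcov G b (rrField G b rrEquiv₃))
    have e3 := sqrt_tnormSq_sub_le b hs hpos (tcov G b (rrField G b rrEquiv₁)) (tcov G b (rrField G b rrEquiv₂))
    linarith [hb rrEquiv₁, hb rrEquiv₂, hb rrEquiv₃, hb rrEquiv₄]
  have e4 := sqrt_tnormSq_sub_sub_add_le b hs hpos
    (treindex (Equiv.ofBijective ![(2 : Fin 4), 3, 0, 1] (by decide)).optionCongr (tcov G b (rrField G b rrEquiv₆)))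
    (treindex (Equiv.ofBijective ![(2 : Fin 4), 3, 1, 0] (by decide)).optionCongr (tcov G b (rrField G b rrEquiv₆)))
    D (treindex (Equiv.swap (0 : Fin 4) 1).optionCongr D)
  rw [tnormSq_treindex, tnormSq_treindex, tnormSq_treindex] at e4
  have h6 := hb rrEquiv₆
  linarith

end SolitonLap

/-! ### `R(·, ∇f) ⋆ Rm = d^∇Ric ∗ Rm` on a gradient soliton -/

section Rdf

variable [Fintype ι] {G : E → E →L[ℝ] E →L[ℝ] ℝ} (b : Basis ι ℝ E) {V : Set E} {x : E}
  [FiniteDimensional ℝ E] [CompleteSpace E] {f : E → ℝ} {lam : ℝ} {α : Type*} [Fintype α] [DecidableEq α]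

omit [Fintype α] [DecidableEq α] in
/-- **`R(·, ∇f) = d^∇Ric` in components** on a gradient soliton: `Σ_j b^j(∇f) R^m_{ijp} =
Σ_l g^{ml} [(∇_{b_p}Ric)(b_l,b_i) − (∇_{b_l}Ric)(b_p,b_i)]` (`cov₂At_ricAt_sub_of_soliton` and pair
symmetry). [cite: EminentiLanaveMantegazza2008, Prop. 2.1] -/
theorem IsMetricOn.sum_coord_sharpAt_mul_riemCoef (hG : IsMetricOn G V) (hx : x ∈ V)
    (hf : ContDiffOn ℝ ∞ f V)
    (hsol : ∀ y ∈ V, ∀ v w, ricAt G y v w + hessAt G f y v w = lam * G y v w) (i p m : ι) :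
    ∑ j, b.coord j (sharpAt G x (fderiv ℝ f x)) * riemCoef G b x i j p m =
      ∑ l, ginv G b x m l * (tcov G b (ric2 G b) x (ocons p ![l, i]) - tcov G b (ric2 G b) x (ocons l ![p, i])) := by
  have hi := hG.isInvertible x hx
  have hs := hG.symm x hx
  set v := sharpAt G x (fderiv ℝ f x) with hv
  have h1 : ∑ j, b.coord j v * riemCoef G b x i j p m = b.coord m (riemAt G x (b i) v (b p)) := by
    conv_rhs => rw [← sum_coord_smul b v, ← riemCLM_apply]
    simp only [riemCoef, ← riemCLM_apply, map_sum, map_smul, _root_.sum_apply, _root_.smul_apply,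
      smul_eq_mul]
  rw [h1, coord_eq_sum_ginv b hi]
  refine Finset.sum_congr rfl fun l _ ↦ ?_
  rw [hG.tcov_ric2 b hx, hG.tcov_ric2 b hx, hG.cov₂At_ricAt_sub_of_soliton hx hf hsol,
    hG.apply_riemAt_pair_comm hx (b i) v (b p) (b l), ← apply_apply_sharpAt hi hs (fderiv ℝ f x)]

/-- **The soliton term `Σ_j b^j(∇f) Σ_a R^m_{ij I_a} T_{I[a↦m]}` is a sum of traces of `K ⊗ T`**
with the kernel `K = (∇ric2 − ∇ric2 ∘ kerSwap₁₂) ∘ kerCyc⁻¹` (the bookkeeping of the `∂_tΓ ∗ T`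
term of the Ricci flow, `sum_chrDot_mul_eq`). [cite: MunteanuWang2015, Thm. 1.4 (proof) and (u1)] -/
theorem IsMetricOn.sum_coord_sharpAt_ricTerm_eq (hG : IsMetricOn G V) (hx : x ∈ V)
    (hf : ContDiffOn ℝ ∞ f V)
    (hsol : ∀ y ∈ V, ∀ v w, ricAt G y v w + hessAt G f y v w = lam * G y v w)
    (T : E → (α → ι) → ℝ) (i : ι) (I : α → ι) :
    ∑ j, b.coord j (sharpAt G x (fderiv ℝ f x)) * ∑ a, ∑ m, riemCoef G b x i j (I a) m * T x (update I a m) =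
      ∑ a, ttr G b (treindex (gamEquiv a) (tprod (treindex kerCyc.symm
        (tcov G b (ric2 G b) - treindex kerSwap₁₂ (tcov G b (ric2 G b)))) T)) x (ocons i I) := by
  have hK : ∀ p l, treindex kerCyc.symm (tcov G b (ric2 G b) - treindex kerSwap₁₂ (tcov G b (ric2 G b))) x
      (ocons i ![p, l]) = tcov G b (ric2 G b) x (ocons p ![l, i]) - tcov G b (ric2 G b) x (ocons l ![p, i]) := by
    intro p l
    have h1 : ocons i ![p, l] ∘ (kerCyc.symm : Option (Fin 2) ≃ Option (Fin 2)) = ocons p ![l, i] := by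
      funext o
      rcases o with _ | c
      · rfl
      · fin_cases c <;> rfl
    rw [treindex_apply, h1]
    simp only [Pi.sub_apply, treindex_apply, ocons_vec2_comp_kerSwap]
  have hL : ∑ j, b.coord j (sharpAt G x (fderiv ℝ f x)) * ∑ a, ∑ m, riemCoef G b x i j (I a) m * T x (update I a m) =
      ∑ a, ∑ m, (∑ j, b.coord j (sharpAt G x (fderiv ℝ f x)) * riemCoef G b x i j (I a) m) * T x (update I a m) := by
    simp only [Finset.mul_sum, Finset.sum_mul]
    symm
    rw [sum_comm₃']
    exact Finset.sum_congr rfl fun j _ ↦ Finset.sum_congr rfl fun a _ ↦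
      Finset.sum_congr rfl fun m _ ↦ by ring
  rw [hL]
  refine Finset.sum_congr rfl fun a _ ↦ ?_
  rw [ttr_apply]
  refine Finset.sum_congr rfl fun m _ ↦ ?_
  rw [hG.sum_coord_sharpAt_mul_riemCoef b hx hf hsol, Finset.sum_mul]
  refine Finset.sum_congr rfl fun l _ ↦ ?_
  rw [treindex_apply, tprod_apply, (ocons₃_comp_gamEquiv a m l i I).1, (ocons₃_comp_gamEquiv a m l i I).2, hK]
  ring

end Rdf

/-! ### `Δ_f ∇Rm = 3λ ∇Rm + Rm ∗ ∇Rm` (Munteanu–Wang's (u1)) and the drift inequality -/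

section MainIdentity

variable [Fintype ι] {G : E → E →L[ℝ] E →L[ℝ] ℝ} (b : Basis ι ℝ E) {V : Set E} {x : E}
  [FiniteDimensional ℝ E] [CompleteSpace E] {f : E → ℝ} {lam : ℝ}

/-- **Munteanu–Wang 2015, Prop. 2.2, formula (u1): `Δ_f(∇Rm) = 3λ ∇Rm + Rm ∗ ∇Rm` on a gradient
Ricci soliton** `Ric + Hess f = λG` (`λ = ½`: `Δ_f ∇Rm = (3/2)∇Rm + Rm ∗ ∇Rm`, i.e. `∇Rm + Rm ∗ ∇Rm`
in their normalisation `Ric + Hess f = ½g` after rescaling), in the rank-generic component calculus,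
with every `∗`-term explicit: at `x ∈ V`, for every index `K`,
`(Δ∇Rm)_K − (∇_{∇f}∇Rm)_K = 3λ (∇Rm)_K + ([Δ,∇]Rm)_K + (∇(Δ_fRm − 2λRm))_K − (Ric ⋆ ∇Rm)_K − (d^∇Ric ∗ Rm)_K`.
Proof: `Δ∇ = ∇Δ + [Δ,∇]` (`tlap_tcov_sub_tcov_tlap`); `ΔRm = ∇_{∇f}Rm + 2λRm + (Δ_fRm − 2λRm)`;
`∇(∇_{∇f}Rm) = (∇∇f) ⋆ ∇Rm + ∇²_{·,∇f}Rm` (Leibniz rule `tcov_sum_mul_ocons_apply`) with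
`∇∇f = λ − Ric` (`fderiv_coord_sharpAt_add`), and `∇²_{i,∇f}Rm − ∇²_{∇f,i}Rm = −R(b_i,∇f) ⋆ Rm`
(Ricci identity `tcov_tcov_antisymm`) `= −d^∇Ric ∗ Rm` (`sum_coord_sharpAt_ricTerm_eq`).
[cite: MunteanuWang2015, Thm. 1.4 (proof) and (u1)] -/
theorem IsMetricOn.tlap_tcov_rm4_sub_drift_of_soliton (hG : IsMetricOn G V) (hx : x ∈ V)
    (hf : ContDiffOn ℝ ∞ f V)
    (hsol : ∀ y ∈ V, ∀ v w, ricAt G y v w + hessAt G f y v w = lam * G y v w)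
    (K : Option (Fin 4) → ι) :
    tlap G b (tcov G b (rm4 G b)) x K
      - ∑ q, b.coord q (sharpAt G x (fderiv ℝ f x)) * tcov G b (tcov G b (rm4 G b)) x (ocons q K) =
    3 * lam * tcov G b (rm4 G b) x K
      + ttr G b (tcov G b (tcov2Alt G b (rm4 G b))
          + treindex (Equiv.swap (some none) (some (some none))) (tcov2Alt G b (tcov G b (rm4 G b)))) x K
      + tcov G b (fun y J ↦ tlap G b (rm4 G b) y J
          - ∑ q, b.coord q (sharpAt G y (fderiv ℝ f y)) * tcov G b (rm4 G b) y (ocons q J)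
          - 2 * lam * rm4 G b y J) x K
      - ricSlot G b (tcov G b (rm4 G b)) none x K
      - ∑ a, ttr G b (treindex (gamEquiv a) (tprod (treindex kerCyc.symm
          (tcov G b (ric2 G b) - treindex kerSwap₁₂ (tcov G b (ric2 G b)))) (rm4 G b))) x K := by
  obtain ⟨i, I, rfl⟩ : ∃ i I, K = ocons i I := ⟨K none, K ∘ some, (ocons_eta K).symm⟩
  have hV := hG.isOpen
  have hi := hG.isInvertible x hx
  have hT := hG.tsmoothOn_rm4 b
  have hD : TSmoothOn (tcov G b (rm4 G b)) V := hG.tsmoothOn_tcov hT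
  have hcs : ∀ q, ContDiffOn ℝ ∞ (fun y ↦ b.coord q (sharpAt G y (fderiv ℝ f y))) V :=
    fun q ↦ hG.contDiffOn_coord_sharpAt_fderiv hf q
  have hdr : TSmoothOn (fun y J ↦ ∑ q, b.coord q (sharpAt G y (fderiv ℝ f y)) *
      tcov G b (rm4 G b) y (ocons q J)) V :=
    fun J ↦ ContDiffOn.sum fun q _ ↦ (hcs q).mul (hD _)
  have hΦ : TSmoothOn (fun y J ↦ tlap G b (rm4 G b) y J
      - ∑ q, b.coord q (sharpAt G y (fderiv ℝ f y)) * tcov G b (rm4 G b) y (ocons q J)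
      - 2 * lam * rm4 G b y J) V :=
    fun J ↦ ((hG.tsmoothOn_tlap hT J).sub (hdr J)).sub (contDiffOn_const.mul (hT J))
  -- (1) the commutator `Δ∇ − ∇Δ`
  have h1 := hG.tlap_tcov_sub_tcov_tlap (b := b) hT hx i I
  -- (2) `∇ΔRm = ∇(∇_{∇f}Rm) + 2λ∇Rm + ∇(Δ_fRm − 2λRm)`
  have h2 : tcov G b (tlap G b (rm4 G b)) x (ocons i I) =
      tcov G b (fun y J ↦ ∑ q, b.coord q (sharpAt G y (fderiv ℝ f y)) * tcov G b (rm4 G b) y (ocons q J)) x (ocons i I)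
        + 2 * lam * tcov G b (rm4 G b) x (ocons i I)
        + tcov G b (fun y J ↦ tlap G b (rm4 G b) y J
          - ∑ q, b.coord q (sharpAt G y (fderiv ℝ f y)) * tcov G b (rm4 G b) y (ocons q J)
          - 2 * lam * rm4 G b y J) x (ocons i I) := by
    have hsum : tlap G b (rm4 G b) =
        (fun y J ↦ ∑ q, b.coord q (sharpAt G y (fderiv ℝ f y)) * tcov G b (rm4 G b) y (ocons q J))
          + (2 * lam) • rm4 G b
          + (fun y J ↦ tlap G b (rm4 G b) y J
            - ∑ q, b.coord q (sharpAt G y (fderiv ℝ f y)) * tcov G b (rm4 G b) y (ocons q J)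
            - 2 * lam * rm4 G b y J) := by
      funext y J
      simp only [Pi.add_apply, Pi.smul_apply, smul_eq_mul]
      ring
    have h := congrArg (fun X ↦ tcov G b X x (ocons i I)) hsum
    rw [h, tcov_add_apply hV (hdr.add (hT.smul _)) hΦ hx, tcov_add_apply hV hdr (hT.smul _) hx,
      tcov_smul_apply hV hT _ hx]
  -- (3) the Leibniz rule for `∇_{∇f}Rm = Σ_q b^q(∇f) (∇Rm)_{q·}`
  have h3 := tcov_sum_mul_ocons_apply (G := G) (b := b) hV hD hcs hx i I
  -- (4) `∇∇f = λ − Ric`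
  have h4 : ∑ j, (fderiv ℝ (fun y ↦ b.coord j (sharpAt G y (fderiv ℝ f y))) x (b i)
      + ∑ m, chrCoef G b x i m j * b.coord m (sharpAt G x (fderiv ℝ f x))) * tcov G b (rm4 G b) x (ocons j I) =
      lam * tcov G b (rm4 G b) x (ocons i I) - ricSlot G b (tcov G b (rm4 G b)) none x (ocons i I) := by
    have hcoef : ∀ j, fderiv ℝ (fun y ↦ b.coord j (sharpAt G y (fderiv ℝ f y))) x (b i)
        + ∑ m, chrCoef G b x i m j * b.coord m (sharpAt G x (fderiv ℝ f x)) =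
        lam * b.coord j (b i) - ∑ k, ginv G b x j k * ricAt G x (b k) (b i) := by
      intro j
      rw [hG.fderiv_coord_sharpAt_add hx hf i j, coord_eq_sum_ginv b hi (b i) j, Finset.mul_sum,
        ← Finset.sum_sub_distrib]
      refine Finset.sum_congr rfl fun k _ ↦ ?_
      have hH := hsol x hx (b i) (b k)
      rw [hG.ricAt_comm hx (b k) (b i)]
      linear_combination ginv G b x j k * hH
    have e1 : ∑ j, lam * b.coord j (b i) * tcov G b (rm4 G b) x (ocons j I) =
        lam * tcov G b (rm4 G b) x (ocons i I) := by
      rw [← sum_coord_basis_mul (b := b) (fun j ↦ tcov G b (rm4 G b) x (ocons j I)) i, Finset.mul_sum]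
      exact Finset.sum_congr rfl fun j _ ↦ by ring
    have e2 : ∑ j, (∑ k, ginv G b x j k * ricAt G x (b k) (b i)) * tcov G b (rm4 G b) x (ocons j I) =
        ricSlot G b (tcov G b (rm4 G b)) none x (ocons i I) := by
      simp only [ricSlot, ocons_none, update_ocons_none]
    simp only [hcoef, sub_mul, Finset.sum_sub_distrib, e1, e2]
  -- (5) the Ricci identity and `R(·,∇f) ⋆ Rm = d^∇Ric ∗ Rm`
  have h5 : ∑ j, b.coord j (sharpAt G x (fderiv ℝ f x)) * tcov G b (tcov G b (rm4 G b)) x (ocons i (ocons j I)) =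
      ∑ j, b.coord j (sharpAt G x (fderiv ℝ f x)) * tcov G b (tcov G b (rm4 G b)) x (ocons j (ocons i I))
        - ∑ a, ttr G b (treindex (gamEquiv a) (tprod (treindex kerCyc.symm
          (tcov G b (ric2 G b) - treindex kerSwap₁₂ (tcov G b (ric2 G b)))) (rm4 G b))) x (ocons i I) := by
    have hR : ∀ j, tcov G b (tcov G b (rm4 G b)) x (ocons i (ocons j I)) =
        tcov G b (tcov G b (rm4 G b)) x (ocons j (ocons i I))
          - ∑ a, ∑ m, riemCoef G b x i j (I a) m * rm4 G b x (update I a m) := by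
      intro j
      have h := hG.tcov_tcov_antisymm (b := b) hT hx i j I
      linarith
    simp only [hR, mul_sub, Finset.sum_sub_distrib]
    rw [hG.sum_coord_sharpAt_ricTerm_eq b hx hf hsol (rm4 G b) i I]
  linear_combination h1 + h2 + h3 + h4 + h5

/-- **Munteanu–Wang 2015, proof of Thm. 1.4 (the Shi-type estimate, p. 6): the drift inequality
for `|∇Rm|²` on a gradient Ricci soliton, in coordinates.** For metric components with
`Ric + Hess f = λG` on `V`, at a positive definite point `x ∈ V` and in any basis `b`,
`Δ|∇Rm|² − d|∇Rm|²(∇f) ≥ 2|∇²Rm|² + 6λ|∇Rm|² − 84 n √(|Rm|²) |∇Rm|²`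
(`n = card ι`; for `λ = ½`: `Δ_f|∇Rm|² ≥ 2|∇²Rm|² + 3|∇Rm|² − C|Rm||∇Rm|²`). Proof:
`Δ|∇Rm|² = 2⟨Δ∇Rm, ∇Rm⟩ + 2|∇∇Rm|²` (`lapAt_tnormSq`), `d|∇Rm|²(∇f) = 2⟨∇_{∇f}∇Rm, ∇Rm⟩`
(`fderiv_tnormSq`), `Δ_f∇Rm = 3λ∇Rm + Rm ∗ ∇Rm` ((u1), `tlap_tcov_rm4_sub_drift_of_soliton`) and the
four `∗`-terms are bounded by `(13 + 20 + 1 + 8) n |Rm| |∇Rm|` (Cauchy–Schwarz).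
[cite: MunteanuWang2015, Thm. 1.4 (proof) and (u1)] -/
theorem IsMetricOn.lapAt_tnormSq_tcov_rm4_sub_fderiv_ge_of_soliton (hG : IsMetricOn G V) (hx : x ∈ V)
    (hpos : ∀ v, v ≠ 0 → 0 < G x v v) (hf : ContDiffOn ℝ ∞ f V)
    (hsol : ∀ y ∈ V, ∀ v w, ricAt G y v w + hessAt G f y v w = lam * G y v w) :
    2 * tnormSq G b (tcov G b (tcov G b (rm4 G b))) x + 6 * lam * tnormSq G b (tcov G b (rm4 G b)) x
      - 84 * Fintype.card ι * Real.sqrt (tnormSq G b (rm4 G b) x) * tnormSq G b (tcov G b (rm4 G b)) x ≤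
    lapAt G (tnormSq G b (tcov G b (rm4 G b))) x
      - fderiv ℝ (tnormSq G b (tcov G b (rm4 G b))) x (sharpAt G x (fderiv ℝ f x)) := by
  have hs := hG.symm x hx
  have hT := hG.tsmoothOn_rm4 b
  have hD : TSmoothOn (tcov G b (rm4 G b)) V := hG.tsmoothOn_tcov hT
  -- the Laplacian and the drift of `|∇Rm|²`
  have hlap := hG.lapAt_tnormSq (b := b) hD hx
  have hdrift : fderiv ℝ (tnormSq G b (tcov G b (rm4 G b))) x (sharpAt G x (fderiv ℝ f x)) =
      2 * tinner G b (fun y K ↦ ∑ q, b.coord q (sharpAt G x (fderiv ℝ f x)) *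
        tcov G b (tcov G b (rm4 G b)) y (ocons q K)) (tcov G b (rm4 G b)) x := by
    conv_lhs => rw [← sum_coord_smul b (sharpAt G x (fderiv ℝ f x))]
    rw [map_sum]
    simp only [map_smul, smul_eq_mul, hG.fderiv_tnormSq hD hx]
    rw [tinner_sum_mul_ocons, Finset.mul_sum]
    exact Finset.sum_congr rfl fun q _ ↦ by ring
  -- (u1) paired against `∇Rm`
  have hid : ∀ K, (tlap G b (tcov G b (rm4 G b)) - fun y K ↦ ∑ q, b.coord q (sharpAt G x (fderiv ℝ f x)) *
      tcov G b (tcov G b (rm4 G b)) y (ocons q K)) x K =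
      ((3 * lam) • tcov G b (rm4 G b)
        + (ttr G b (tcov G b (tcov2Alt G b (rm4 G b))
            + treindex (Equiv.swap (some none) (some (some none))) (tcov2Alt G b (tcov G b (rm4 G b))))
          + tcov G b (fun y J ↦ tlap G b (rm4 G b) y J
            - ∑ q, b.coord q (sharpAt G y (fderiv ℝ f y)) * tcov G b (rm4 G b) y (ocons q J)
            - 2 * lam * rm4 G b y J)
          - ricSlot G b (tcov G b (rm4 G b)) none
          - ∑ a, ttr G b (treindex (gamEquiv a) (tprod (treindex kerCyc.symm
            (tcov G b (ric2 G b) - treindex kerSwap₁₂ (tcov G b (ric2 G b)))) (rm4 G b))))) x K := by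
    intro K
    have h := hG.tlap_tcov_rm4_sub_drift_of_soliton b hx hf hsol K
    simp only [Pi.sub_apply, Pi.add_apply, Pi.smul_apply, smul_eq_mul, Finset.sum_apply]
    linarith
  have hpair := tinner_congr_apply (G := G) (b := b) hid (fun _ : Option (Fin 4) → ι ↦ (rfl : tcov G b (rm4 G b) x _ = _))
  simp only [tinner_sub_left, tinner_add_left, tinner_smul_left] at hpair
  rw [← tnormSq_eq] at hpair
  -- the four bounds, through Cauchy–Schwarz
  have b1 := abs_le.mp (abs_tinner_le_of_sqrt_le b hs hpos (T := tcov G b (rm4 G b))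
    (hG.sqrt_tnormSq_commutator_le b hx hpos))
  have b2 := abs_le.mp (abs_tinner_le_of_sqrt_le b hs hpos (T := tcov G b (rm4 G b))
    (hG.sqrt_tnormSq_tcov_lapDrift_le b hx hpos hf hsol))
  have b3 := abs_le.mp (abs_tinner_le_of_sqrt_le b hs hpos (T := tcov G b (rm4 G b))
    (hG.sqrt_tnormSq_ricSlot_le b hx hpos (tcov G b (rm4 G b)) none))
  have b4 := abs_le.mp (abs_tinner_le_of_sqrt_le b hs hpos (T := tcov G b (rm4 G b))
    (hG.sqrt_tnormSq_rdf_le b hx hpos))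
  -- arithmetic
  set n : ℝ := (Fintype.card ι : ℝ) with hn
  set r := Real.sqrt (tnormSq G b (rm4 G b) x) with hr
  set d := Real.sqrt (tnormSq G b (tcov G b (rm4 G b)) x) with hd
  have hdd : d * d = tnormSq G b (tcov G b (rm4 G b)) x := Real.mul_self_sqrt (tnormSq_nonneg b hs hpos _)
  have hprod : ∀ c : ℝ, c * n * r * d * d = c * n * r * tnormSq G b (tcov G b (rm4 G b)) x := by
    intro c; rw [mul_assoc (c * n * r) d d, hdd]
  rw [hlap, hdrift]
  linarith [hpair, b1.1, b2.1, b3.2, b4.2, hprod 13, hprod 20, hprod 8, hprod 1]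

end MainIdentity

end MetricCoord

end Literature.Geometry.Lorentzian

end
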